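import Mathlib.NumberTheory.DiophantineApproximation.Basic
import Literature.NumberTheory.Sieve.RoughNumbersCoprimeProgressions
import Literature.NumberTheory.Sieve.DivisorBound
import HarnessLib

/-!
# Heath-Brown's bound for the additive energy of the modular inverses of an interval

Topic `Literature/NumberTheory/Sieve` (a brick of the `τ₃`-in-progressions theorem: Fouvry–Tenenbaum's
Lemma 4.13 = Heath-Brown's Theorem 1, see `FouvryTenenbaumDivisorAPProofs.lean`).  Source:
D. R. Heath-Brown, *The divisor function `d₃(n)` in arithmetic progressions*, Acta Arith. 47 (1986)
29–56 [HeathBrown1986d3], §6 "The second auxiliary bound", displays (6.5)–(6.13) (pp. 45–47), whose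
"first treatment of `H(𝒥, q)` follows Heath-Brown ([13], pp. 367–368)" ([13] = D. R. Heath-Brown,
*Almost-primes in arithmetic progressions and short intervals*, Math. Proc. Cambridge Philos. Soc. 83
(1978) 357–375).  Everything here is PROVED (three counting definitions, theorems only otherwise).

## The statement (6.13) and its proof (6.6)–(6.12), as printed (p. 46–47)

For an interval `𝒥 = (V, ζV]` of `J` integers and `q ≥ 1` put (6.6)
`m(s) = #{v₁, v₂ ∈ 𝒥 : v̄₁ + v̄₂ ≡ s (mod q)}` (`v̄` the inverse `mod q`, so `(vᵢ, q) = 1`), so that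
`H(𝒥, q) = ∑_{s=1}^{q} m(s)²` (the number of solutions of `v̄₁ + v̄₂ ≡ v̄₃ + v̄₄ (mod q)`, (6.5)).
"Each `v₁` in (6.6) determines `v₂ (mod q)`, and therefore (6.7) `m(s) ≪ J(1 + q⁻¹J)`. Hence (6.8)
`H(𝒥, q) ≪ J(1 + q⁻¹J) ∑_s m(s) ≪ J³(1 + q⁻¹J)`. This trivial bound suffices unless `J ≤ q`, as we now
assume. If `(s, q) = d` then (6.6) requires `d ∣ v̄₁ + v̄₂`. Thus, for any `d ∣ q` we have (6.9)
`∑_{d ∣ s} m(s) ≪ J(1 + d⁻¹J)`. Since `J ≤ q`, it follows from (6.7) that `m(s) ≪ J`, whence (6.10)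
`∑_{d∣q, d>D} ∑_{(s,q)=d} m(s)² ≪ d(q) J²(1 + D⁻¹J)`.  For small values of `(s, q) = d` we shall apply
the strong form of Dirichlet's approximation theorem … for any positive integer `L` there exist integers
`α, β` for which `0 < α ≤ L`, `|s/q − β/α| ≤ 1/(α(L+1))`. Hence `sα ≡ γ (mod q)` with `0 < α ≤ L`,
`|γ| ≤ q/(L+1)`. We shall choose `L = min(q/d − 1, [(qV)^{1/2}])`. Thus `qd⁻¹ ∤ α`, whence `q ∤ sα`, so
that `γ ≠ 0`. The relation `v̄₁ + v̄₂ ≡ s (mod q)` now yields `α(v₁ + v₂) ≡ γv₁v₂ (mod q)`, whence (6.11)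
`α(v₁ + v₂) = γv₁v₂ − qt` for some integer `t`. The bounds for `α, γ` and `vᵢ` yield
`t ≪ V²dq⁻¹ + V^{3/2}q^{−1/2}`. To each value of `t` there correspond `O(X^ε)` possible pairs `v₁, v₂`.
To prove this we write (6.11) as `(γv₁ − α)(γv₂ − α) = α² + qt`. Here `α, γ` are fixed, so that each `t`
leads to `O(X^ε)` possible factors `γvᵢ − α` of `α² + qt`, except when `α² + qt = 0`. In the latter
case, however, one unknown must be `α/γ` and the other is then determined by `v̄₁ + v̄₂ ≡ s (mod q)`. It
now follows that `m(s) ≪ X^ε(1 + V²dq⁻¹ + V^{3/2}q^{−1/2})`. We may combine this with (6.9) to obtain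
(6.12) `∑_{d∣q, d≤D} ∑_{(s,q)=d} m(s)² ≪ … ≪ X^ε d(q)(JV²Dq⁻¹ + J² + J²V²q⁻¹ + J²V^{3/2}q^{−1/2})`.
If we now choose `D = 1 + [q^{1/2}JV⁻¹]` we may conclude from (6.10) and (6.12) that (6.13)
`H(𝒥, q) ≪ X^ε d(q) J²(1 + V²q⁻¹ + V^{3/2}q^{−1/2})`."

## What is formalized

* `unitsIn q S`, `invPairCount q S s = m(s)`, `invEnergy q S = H(𝒥, q)` for an arbitrary finite set
  `S = 𝒥 ⊆ ℕ` (`invEnergy_eq_card`: the number of quadruples; `sum_invPairCount`: `∑_s m(s) = #𝒥*²`);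
* (6.7) `invPairCount_le`, (6.9) `sum_invPairCount_cast_eq_zero_le` (the classes `s` with `d ∣ s`,
  i.e. in the kernel of `ℤ/q → ℤ/d`), for any `𝒥 ⊆ (A, B]`, with `(B − A)/q + 1`, resp. `(B − A)/d + 1`;
* (6.11) `invPairCount_le_of_gcd` (with `exists_dirichlet_data`, `dvd_of_inv_add_inv_eq`,
  `card_le_two_mul_card_divisors`, `card_le_of_mul_eq_zero`): for `(s, q) = d ≤ q/2`, `𝒥 ⊆ (A, B]`,
  `B ≤ 2V`:  `m(s) ≤ (8V²d/q + 16V^{3/2}q^{−1/2} + 3)(2M + 2((B − A)/q + 1))`, `M` a bound for `d(n)`,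
  `n ≤ 9q³V²` (explicit constants: `|t| ≤ 4LV/q + 4V²/(L+1)`, `|α² − γqt| ≤ 9q³V²`);
* **`invEnergy_le`** — (6.13): for every `ε > 0` there is `C` with
  `H(𝒥, q) ≤ C (qV)^ε d(q) J² (1 + V²/q + V^{3/2}q^{−1/2})` for all `q ≥ 1`, `V ≥ 1`, `V ≤ A`, `B ≤ 2V`,
  `𝒥 ⊆ (A, B]`, `J = (B − A) + 1` (`C = 62(2C_τ3^ε + 4)`, `C_τ` from the divisor bound
  `DivisorBound.exists_card_divisors_le_mul_rpow` at exponent `ε/3`).  The source's `X^ε` (`X ≥ q, V`)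
  is rendered as `(qV)^ε`; `𝒥 ⊆ (V, 2V]` arbitrary (the proof only uses `v ≤ 2V` and `#𝒥 ≤ J`; the
  count is monotone in `𝒥`, which is how the classes `mod D` of Fouvry–Tenenbaum enter at no cost).

## References

* D. R. Heath-Brown, Acta Arith. 47 (1986) 29–56, §6, (6.5)–(6.13). [HeathBrown1986d3]
* D. R. Heath-Brown, Math. Proc. Cambridge Philos. Soc. 83 (1978) 357–375, pp. 367–368 (the original
  treatment of `H(𝒥, q)`, cited as [13] in the above).
* G. H. Hardy, E. M. Wright, *An Introduction to the Theory of Numbers*, Thm 36 (Dirichlet's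
  approximation theorem; Mathlib: `Real.exists_int_int_abs_mul_sub_le`).
-/

open Finset

noncomputable section

namespace Literature.NumberTheory.Sieve

namespace HeathBrown1986

/-! ### The counting functions `m(s)` and `H(𝒥, q)` -/

/-- The elements of `S` prime to `q` (the `v ∈ 𝒥` with `v̄` defined). [cite: HeathBrown1986d3, §6 (6.6)] -/
def unitsIn (q : ℕ) (S : Finset ℕ) : Finset ℕ := S.filter (fun v => v.Coprime q)

/-- `m(s) = #{v₁, v₂ ∈ 𝒥 : (v₁v₂, q) = 1, v̄₁ + v̄₂ ≡ s (mod q)}` (Heath-Brown's (6.6); `v̄` the inverse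
`mod q`). [cite: HeathBrown1986d3, §6 (6.6)] -/
def invPairCount (q : ℕ) (S : Finset ℕ) (s : ZMod q) : ℕ :=
  ((unitsIn q S ×ˢ unitsIn q S).filter
    (fun p : ℕ × ℕ => ((p.1 : ZMod q))⁻¹ + ((p.2 : ZMod q))⁻¹ = s)).card

/-- `H(𝒥, q) = ∑_{s mod q} m(s)² = #{v₁, …, v₄ ∈ 𝒥 : (vᵢ, q) = 1, v̄₁ + v̄₂ ≡ v̄₃ + v̄₄ (mod q)}`, the
additive energy of the inverses `mod q` of the units of `𝒥`. [cite: HeathBrown1986d3, §6 (6.5)–(6.6)] -/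
def invEnergy (q : ℕ) [NeZero q] (S : Finset ℕ) : ℕ := ∑ s : ZMod q, invPairCount q S s ^ 2

/-- Membership in `unitsIn`. [folklore] -/
theorem mem_unitsIn {q : ℕ} {S : Finset ℕ} {v : ℕ} : v ∈ unitsIn q S ↔ v ∈ S ∧ v.Coprime q := by
  simp [unitsIn]

/-- The elements of `unitsIn q S` are units `mod q`. [folklore] -/
theorem isUnit_of_mem_unitsIn {q : ℕ} {S : Finset ℕ} {v : ℕ} (h : v ∈ unitsIn q S) :
    IsUnit ((v : ℕ) : ZMod q) :=
  (ZMod.isUnit_iff_coprime v q).mpr (mem_unitsIn.mp h).2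

/-- `#𝒥* ≤ #𝒥`. [folklore] -/
theorem card_unitsIn_le {q : ℕ} (S : Finset ℕ) : (unitsIn q S).card ≤ S.card := Finset.card_filter_le _ _

/-- `∑_s m(s) = #𝒥*²`. [folklore] -/
theorem sum_invPairCount (q : ℕ) [NeZero q] (S : Finset ℕ) :
    ∑ s : ZMod q, invPairCount q S s = (unitsIn q S).card ^ 2 := by
  classical
  unfold invPairCount
  rw [← Finset.card_eq_sum_card_fiberwise (f := fun p : ℕ × ℕ => ((p.1 : ZMod q))⁻¹ + ((p.2 : ZMod q))⁻¹)
    (t := Finset.univ) (fun p _ => Finset.mem_coe.mpr (Finset.mem_univ _)), Finset.card_product, sq]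

/-- `H(𝒥, q)` is the number of quadruples: `∑_s m(s)² = #{(v₁,…,v₄) : v̄₁ + v̄₂ = v̄₃ + v̄₄}`.
[cite: HeathBrown1986d3, §6 (6.5)–(6.6)] -/
theorem invEnergy_eq_card (q : ℕ) [NeZero q] (S : Finset ℕ) :
    invEnergy q S = (((unitsIn q S ×ˢ unitsIn q S) ×ˢ (unitsIn q S ×ˢ unitsIn q S)).filter
      (fun x : (ℕ × ℕ) × (ℕ × ℕ) => ((x.1.1 : ZMod q))⁻¹ + ((x.1.2 : ZMod q))⁻¹ =
        ((x.2.1 : ZMod q))⁻¹ + ((x.2.2 : ZMod q))⁻¹)).card := by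
  classical
  set P := unitsIn q S ×ˢ unitsIn q S with hP
  set f : ℕ × ℕ → ZMod q := fun p => ((p.1 : ZMod q))⁻¹ + ((p.2 : ZMod q))⁻¹ with hf
  have hRHS : ((P ×ˢ P).filter (fun x : (ℕ × ℕ) × (ℕ × ℕ) => f x.1 = f x.2)).card =
      ∑ s : ZMod q, ((P ×ˢ P).filter (fun x : (ℕ × ℕ) × (ℕ × ℕ) => f x.1 = f x.2 ∧ f x.1 = s)).card := by
    rw [Finset.card_eq_sum_card_fiberwise (f := fun x : (ℕ × ℕ) × (ℕ × ℕ) => f x.1) (t := Finset.univ)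
      (fun x _ => Finset.mem_coe.mpr (Finset.mem_univ _))]
    refine Finset.sum_congr rfl fun s _ => ?_
    rw [Finset.filter_filter]
  have hfib : ∀ s : ZMod q,
      (P ×ˢ P).filter (fun x : (ℕ × ℕ) × (ℕ × ℕ) => f x.1 = f x.2 ∧ f x.1 = s) =
        (P.filter (fun p => f p = s)) ×ˢ (P.filter (fun p => f p = s)) := by
    intro s
    ext x
    simp only [Finset.mem_filter, Finset.mem_product]
    constructor
    · rintro ⟨⟨h1, h2⟩, h3, h4⟩; exact ⟨⟨h1, h4⟩, h2, by rw [← h3, h4]⟩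
    · rintro ⟨⟨h1, h2⟩, h3, h4⟩; exact ⟨⟨h1, h3⟩, by rw [h2, h4], h2⟩
  unfold invEnergy invPairCount
  rw [hRHS]
  refine Finset.sum_congr rfl fun s _ => ?_
  rw [hfib s, Finset.card_product, sq]

/-! ### Counting in a residue class -/

/-- `#{A < v ≤ B : v ≡ c (mod n)} ≤ (B − A)/n + 1` for `n ≥ 1` (natural subtraction). [folklore] -/
theorem card_Ioc_filter_natCast_eq_le {n : ℕ} (hn : 0 < n) (A B : ℕ) (c : ZMod n) :
    ((((Ioc A B).filter (fun v : ℕ => (v : ZMod n) = c)).card : ℕ) : ℝ) ≤ ((B - A : ℕ) : ℝ) / n + 1 := by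
  haveI : NeZero n := ⟨hn.ne'⟩
  rcases lt_or_ge B A with hBA | hAB
  · rw [Finset.Ioc_eq_empty (not_lt.mpr hBA.le), Finset.filter_empty, Finset.card_empty, Nat.cast_zero]
    positivity
  · have hset : (Ioc A B).filter (fun v : ℕ => (v : ZMod n) = c) =
        (Ioc A B).filter (fun v : ℕ => v ≡ c.val [MOD n]) := by
      refine Finset.filter_congr fun v _ => ?_
      rw [← ZMod.natCast_eq_natCast_iff, ZMod.natCast_zmod_val]
    rw [hset, Nat.cast_sub hAB]
    have := BFI.abs_card_Ioc_filter_modEq_sub_le hn c.val hAB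
    have h2 := (abs_le.mp this).2
    linarith

/-- For a unit `x` of `ℤ/qℤ`, `x⁻¹ = c` forces `x = c⁻¹`. [folklore] -/
theorem eq_inv_of_inv_eq {q : ℕ} {x c : ZMod q} (hx : IsUnit x) (h : x⁻¹ = c) : x = c⁻¹ := by
  have hc : IsUnit c := by
    rw [← h]; obtain ⟨u, rfl⟩ := hx; rw [ZMod.inv_coe_unit]; exact Units.isUnit _
  calc x = x * (c * c⁻¹) := by rw [ZMod.mul_inv_of_unit c hc, mul_one]
    _ = (x * x⁻¹) * c⁻¹ := by rw [h]; ring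
    _ = c⁻¹ := by rw [ZMod.mul_inv_of_unit x hx, one_mul]

/-- The units of `S ⊆ (A, B]` with a prescribed inverse `mod q` lie in one class `mod q`:
`#{v ∈ 𝒥* : v̄ = c} ≤ (B − A)/q + 1`. [folklore] -/
theorem card_unitsIn_filter_inv_eq_le {q : ℕ} (hq : 0 < q) {S : Finset ℕ} {A B : ℕ} (hS : S ⊆ Ioc A B)
    (c : ZMod q) :
    ((((unitsIn q S).filter (fun v : ℕ => ((v : ZMod q))⁻¹ = c)).card : ℕ) : ℝ) ≤ ((B - A : ℕ) : ℝ) / q + 1 := by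
  haveI : NeZero q := ⟨hq.ne'⟩
  have hsub : (unitsIn q S).filter (fun v : ℕ => ((v : ZMod q))⁻¹ = c) ⊆
      (Ioc A B).filter (fun v : ℕ => (v : ZMod q) = c⁻¹) := by
    intro v hv
    rw [Finset.mem_filter] at hv ⊢
    exact ⟨hS (mem_unitsIn.mp hv.1).1, eq_inv_of_inv_eq (isUnit_of_mem_unitsIn hv.1) hv.2⟩
  calc ((((unitsIn q S).filter (fun v : ℕ => ((v : ZMod q))⁻¹ = c)).card : ℕ) : ℝ)
      ≤ ((((Ioc A B).filter (fun v : ℕ => (v : ZMod q) = c⁻¹)).card : ℕ) : ℝ) := by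
        exact_mod_cast Finset.card_le_card hsub
    _ ≤ ((B - A : ℕ) : ℝ) / q + 1 := card_Ioc_filter_natCast_eq_le hq A B _

/-- **(6.7)**: `m(s) ≤ #𝒥 ((B − A)/q + 1)` for `𝒥 ⊆ (A, B]` — each `v₁` determines `v̄₂ = s − v̄₁`, hence
`v₂ mod q`. [cite: HeathBrown1986d3, §6 (6.7)] -/
theorem invPairCount_le {q : ℕ} (hq : 0 < q) {S : Finset ℕ} {A B : ℕ} (hS : S ⊆ Ioc A B) (s : ZMod q) :
    ((invPairCount q S s : ℕ) : ℝ) ≤ (S.card : ℝ) * (((B - A : ℕ) : ℝ) / q + 1) := by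
  classical
  unfold invPairCount
  rw [Finset.card_filter, Finset.sum_product, Nat.cast_sum]
  have hinner : ∀ v₁ ∈ unitsIn q S,
      ((∑ v₂ ∈ unitsIn q S, (if ((v₁ : ZMod q))⁻¹ + ((v₂ : ZMod q))⁻¹ = s then 1 else 0) : ℕ) : ℝ) ≤
        ((B - A : ℕ) : ℝ) / q + 1 := by
    intro v₁ _
    rw [← Finset.card_filter]
    have hset : (unitsIn q S).filter (fun v₂ : ℕ => ((v₁ : ZMod q))⁻¹ + ((v₂ : ZMod q))⁻¹ = s) =
        (unitsIn q S).filter (fun v₂ : ℕ => ((v₂ : ZMod q))⁻¹ = s - ((v₁ : ZMod q))⁻¹) := by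
      refine Finset.filter_congr fun v₂ _ => ?_
      constructor <;> intro h
      · rw [← h]; ring
      · rw [h]; ring
    rw [hset]
    exact card_unitsIn_filter_inv_eq_le hq hS _
  calc ∑ v₁ ∈ unitsIn q S, ((∑ v₂ ∈ unitsIn q S,
          (if ((v₁ : ZMod q))⁻¹ + ((v₂ : ZMod q))⁻¹ = s then 1 else 0) : ℕ) : ℝ)
      ≤ ∑ _v₁ ∈ unitsIn q S, (((B - A : ℕ) : ℝ) / q + 1) := Finset.sum_le_sum hinner
    _ = ((unitsIn q S).card : ℝ) * (((B - A : ℕ) : ℝ) / q + 1) := by rw [Finset.sum_const, nsmul_eq_mul]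
    _ ≤ (S.card : ℝ) * (((B - A : ℕ) : ℝ) / q + 1) :=
        mul_le_mul_of_nonneg_right (by exact_mod_cast card_unitsIn_le S) (by positivity)

/-- **(6.9)**: for `d ∣ q`, `∑_{s : d ∣ s} m(s) ≤ #𝒥 ((B − A)/d + 1)` — `d ∣ v̄₁ + v̄₂` forces
`v₂ ≡ −v₁ (mod d)`. [cite: HeathBrown1986d3, §6 (6.9)] -/
theorem sum_invPairCount_cast_eq_zero_le {q d : ℕ} [NeZero q] (hd : 0 < d) (hdq : d ∣ q) {S : Finset ℕ}
    {A B : ℕ} (hS : S ⊆ Ioc A B) :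
    ((∑ s ∈ (Finset.univ : Finset (ZMod q)).filter (fun s => (ZMod.castHom hdq (ZMod d) s) = 0),
        invPairCount q S s : ℕ) : ℝ) ≤ (S.card : ℝ) * (((B - A : ℕ) : ℝ) / d + 1) := by
  classical
  haveI : NeZero d := ⟨hd.ne'⟩
  set ψ := ZMod.castHom hdq (ZMod d) with hψ
  -- the sum is a pair count
  have hsum : ∑ s ∈ (Finset.univ : Finset (ZMod q)).filter (fun s => ψ s = 0), invPairCount q S s =
      ((unitsIn q S ×ˢ unitsIn q S).filter
        (fun p : ℕ × ℕ => ψ (((p.1 : ZMod q))⁻¹ + ((p.2 : ZMod q))⁻¹) = 0)).card := by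
    unfold invPairCount
    rw [Finset.card_eq_sum_card_fiberwise
      (f := fun p : ℕ × ℕ => ((p.1 : ZMod q))⁻¹ + ((p.2 : ZMod q))⁻¹)
      (s := (unitsIn q S ×ˢ unitsIn q S).filter
        (fun p : ℕ × ℕ => ψ (((p.1 : ZMod q))⁻¹ + ((p.2 : ZMod q))⁻¹) = 0))
      (t := (Finset.univ : Finset (ZMod q)).filter (fun s => ψ s = 0)) ?_]
    · refine Finset.sum_congr rfl fun s hs => ?_
      rw [Finset.mem_filter] at hs
      rw [Finset.filter_filter]
      congr 1
      refine Finset.filter_congr fun p _ => ?_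
      constructor
      · intro h2; exact ⟨by rw [h2]; exact hs.2, h2⟩
      · rintro ⟨_, h2⟩; exact h2
    · intro p hp
      rw [Finset.mem_coe, Finset.mem_filter] at hp
      rw [Finset.mem_coe, Finset.mem_filter]
      exact ⟨Finset.mem_univ _, hp.2⟩
  rw [hsum]
  -- `ψ(v̄₁) + ψ(v̄₂) = 0` forces `v₂ ≡ -v₁ (mod d)`
  have hclass : ∀ p ∈ (unitsIn q S ×ˢ unitsIn q S).filter
      (fun p : ℕ × ℕ => ψ (((p.1 : ZMod q))⁻¹ + ((p.2 : ZMod q))⁻¹) = 0),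
      ((p.2 : ℕ) : ZMod d) = -((p.1 : ℕ) : ZMod d) := by
    intro p hp
    rw [Finset.mem_filter, Finset.mem_product] at hp
    obtain ⟨⟨h1, h2⟩, h0⟩ := hp
    have hu1 := isUnit_of_mem_unitsIn h1
    have hu2 := isUnit_of_mem_unitsIn h2
    have e1 : ψ (((p.1 : ZMod q))⁻¹) * ((p.1 : ℕ) : ZMod d) = 1 := by
      rw [← map_natCast ψ p.1, ← map_mul, ZMod.inv_mul_of_unit _ hu1, map_one]
    have e2 : ψ (((p.2 : ZMod q))⁻¹) * ((p.2 : ℕ) : ZMod d) = 1 := by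
      rw [← map_natCast ψ p.2, ← map_mul, ZMod.inv_mul_of_unit _ hu2, map_one]
    rw [map_add] at h0
    have key : ((p.2 : ℕ) : ZMod d) + ((p.1 : ℕ) : ZMod d) = 0 := by
      have := congrArg (fun z => z * (((p.1 : ℕ) : ZMod d) * ((p.2 : ℕ) : ZMod d))) h0
      simp only [zero_mul, add_mul] at this
      calc ((p.2 : ℕ) : ZMod d) + ((p.1 : ℕ) : ZMod d)
          = ψ (((p.1 : ZMod q))⁻¹) * ((p.1 : ℕ) : ZMod d) * ((p.2 : ℕ) : ZMod d) +
              ψ (((p.2 : ZMod q))⁻¹) * ((p.2 : ℕ) : ZMod d) * ((p.1 : ℕ) : ZMod d) := by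
            rw [e1, e2]; ring
        _ = 0 := by rw [← this]; ring
    exact eq_neg_of_add_eq_zero_left key
  -- count over `v₁`
  calc (((( unitsIn q S ×ˢ unitsIn q S).filter
        (fun p : ℕ × ℕ => ψ (((p.1 : ZMod q))⁻¹ + ((p.2 : ZMod q))⁻¹) = 0)).card : ℕ) : ℝ)
      ≤ ((((unitsIn q S ×ˢ unitsIn q S).filter
        (fun p : ℕ × ℕ => ((p.2 : ℕ) : ZMod d) = -((p.1 : ℕ) : ZMod d))).card : ℕ) : ℝ) := by
        exact_mod_cast Finset.card_le_card (fun p hp => Finset.mem_filter.mpr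
          ⟨(Finset.mem_filter.mp hp).1, hclass p hp⟩)
    _ = ∑ v₁ ∈ unitsIn q S, ((((unitsIn q S).filter
          (fun v₂ : ℕ => ((v₂ : ℕ) : ZMod d) = -((v₁ : ℕ) : ZMod d))).card : ℕ) : ℝ) := by
        rw [Finset.card_filter, Finset.sum_product, Nat.cast_sum]
        refine Finset.sum_congr rfl fun v₁ _ => ?_
        rw [Finset.card_filter]
    _ ≤ ∑ _v₁ ∈ unitsIn q S, (((B - A : ℕ) : ℝ) / d + 1) := by
        refine Finset.sum_le_sum fun v₁ _ => ?_
        calc ((((unitsIn q S).filter (fun v₂ : ℕ => ((v₂ : ℕ) : ZMod d) = -((v₁ : ℕ) : ZMod d))).card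
              : ℕ) : ℝ)
            ≤ ((((Ioc A B).filter (fun v₂ : ℕ => ((v₂ : ℕ) : ZMod d) = -((v₁ : ℕ) : ZMod d))).card
              : ℕ) : ℝ) := by
              exact_mod_cast Finset.card_le_card (fun v hv => Finset.mem_filter.mpr
                ⟨hS (mem_unitsIn.mp (Finset.mem_filter.mp hv).1).1, (Finset.mem_filter.mp hv).2⟩)
          _ ≤ ((B - A : ℕ) : ℝ) / d + 1 := card_Ioc_filter_natCast_eq_le hd A B _
    _ = ((unitsIn q S).card : ℝ) * (((B - A : ℕ) : ℝ) / d + 1) := by rw [Finset.sum_const, nsmul_eq_mul]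
    _ ≤ (S.card : ℝ) * (((B - A : ℕ) : ℝ) / d + 1) :=
        mul_le_mul_of_nonneg_right (by exact_mod_cast card_unitsIn_le S) (by positivity)

/-! ### The Dirichlet step (6.11): `m(s)` for `(s, q) = d` small -/

/-- The congruence behind (6.11): if `v̄₁ + v̄₂ = s` and `γ ≡ αs (mod q)` then
`q ∣ α(v₁ + v₂) − γ v₁v₂` (multiply by `v₁v₂`). [cite: HeathBrown1986d3, §6 (6.11)] -/
theorem dvd_of_inv_add_inv_eq {q : ℕ} [NeZero q] {v₁ v₂ : ℕ} (h₁ : IsUnit (v₁ : ZMod q))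
    (h₂ : IsUnit (v₂ : ZMod q)) {s : ZMod q} (hs : ((v₁ : ZMod q))⁻¹ + ((v₂ : ZMod q))⁻¹ = s)
    {α γ : ℤ} (hγ : (γ : ZMod q) = (α : ZMod q) * s) :
    (q : ℤ) ∣ α * ((v₁ : ℤ) + v₂) - γ * ((v₁ : ℤ) * v₂) := by
  rw [← ZMod.intCast_zmod_eq_zero_iff_dvd]
  push_cast
  rw [hγ, ← hs]
  have e1 := ZMod.inv_mul_of_unit _ h₁
  have e2 := ZMod.inv_mul_of_unit _ h₂
  calc (α : ZMod q) * ((v₁ : ZMod q) + v₂) -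
        α * (((v₁ : ZMod q))⁻¹ + ((v₂ : ZMod q))⁻¹) * ((v₁ : ZMod q) * v₂)
      = α * ((v₁ : ZMod q) + v₂) -
        α * ((((v₁ : ZMod q))⁻¹ * v₁) * v₂ + (((v₂ : ZMod q))⁻¹ * v₂) * v₁) := by ring
    _ = 0 := by rw [e1, e2]; ring

/-- If `(γv₁ − α)(γv₂ − α) = N ≠ 0` for all pairs in `F` (`γ ≠ 0`), then `#F ≤ 2 d(|N|)`: the pair is
determined by the integer divisor `γv₁ − α` of `N`. [cite: HeathBrown1986d3, §6, after (6.11)] -/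
theorem card_le_two_mul_card_divisors {α γ N : ℤ} (hγ : γ ≠ 0) (hN : N ≠ 0) (F : Finset (ℕ × ℕ))
    (hF : ∀ p ∈ F, (γ * p.1 - α) * (γ * p.2 - α) = N) : F.card ≤ 2 * N.natAbs.divisors.card := by
  classical
  set Z : Finset ℤ := (N.natAbs.divisors.image (fun n : ℕ => (n : ℤ))) ∪
    (N.natAbs.divisors.image (fun n : ℕ => -(n : ℤ))) with hZ
  have hZc : Z.card ≤ 2 * N.natAbs.divisors.card := by
    refine (Finset.card_union_le _ _).trans ?_
    have h1 := Finset.card_image_le (s := N.natAbs.divisors) (f := fun n : ℕ => (n : ℤ))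
    have h2 := Finset.card_image_le (s := N.natAbs.divisors) (f := fun n : ℕ => -(n : ℤ))
    omega
  refine le_trans (Finset.card_le_card_of_injOn (fun p : ℕ × ℕ => γ * p.1 - α) ?_ ?_) hZc
  · intro p hp
    have hp' := hF p (Finset.mem_coe.mp hp)
    have hdvd : (γ * p.1 - α) ∣ N := ⟨_, hp'.symm⟩
    have hmem : (γ * (p.1 : ℤ) - α).natAbs ∈ N.natAbs.divisors :=
      Nat.mem_divisors.mpr ⟨Int.natAbs_dvd_natAbs.mpr hdvd, Int.natAbs_ne_zero.mpr hN⟩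
    rw [Finset.mem_coe, hZ, Finset.mem_union, Finset.mem_image, Finset.mem_image]
    rcases le_or_gt 0 (γ * p.1 - α) with hpos | hneg
    · exact Or.inl ⟨_, hmem, Int.natAbs_of_nonneg hpos⟩
    · refine Or.inr ⟨_, hmem, ?_⟩
      rw [Int.ofNat_natAbs_of_nonpos hneg.le, neg_neg]
  · intro p hp p' hp' h
    simp only at h
    have e := hF p (Finset.mem_coe.mp hp)
    have e' := hF p' (Finset.mem_coe.mp hp')
    have h1 : (p.1 : ℤ) = p'.1 := mul_left_cancel₀ hγ (by linarith)
    have hz0 : γ * (p'.1 : ℤ) - α ≠ 0 := fun h0 => hN (by rw [← e', h0, zero_mul])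
    rw [h, ← e'] at e
    have h2' : γ * (p.2 : ℤ) - α = γ * p'.2 - α := mul_left_cancel₀ hz0 e
    have h2 : (p.2 : ℤ) = p'.2 := mul_left_cancel₀ hγ (by linarith)
    exact Prod.ext (by exact_mod_cast h1) (by exact_mod_cast h2)

/-- At most one natural number `v` has `γ v = α` (`γ ≠ 0`). [folklore] -/
theorem card_filter_mul_eq_le_one {α γ : ℤ} (hγ : γ ≠ 0) (T : Finset ℕ) :
    (T.filter (fun v : ℕ => γ * v = α)).card ≤ 1 := by
  refine Finset.card_le_one.mpr fun v hv w hw => ?_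
  rw [Finset.mem_filter] at hv hw
  have : (v : ℤ) = w := mul_left_cancel₀ hγ (by rw [hv.2, hw.2])
  exact_mod_cast this

/-- The degenerate case `(γv₁ − α)(γv₂ − α) = 0`: one of `v₁, v₂` is `α/γ`, the other lies in one
class `mod q`; at most `2((B − A)/q + 1)` pairs. [cite: HeathBrown1986d3, §6, after (6.11)] -/
theorem card_le_of_mul_eq_zero {q : ℕ} [NeZero q] {S : Finset ℕ} {A B : ℕ} (hS : S ⊆ Ioc A B)
    (s : ZMod q) {α γ : ℤ} (hγ : γ ≠ 0) (F : Finset (ℕ × ℕ))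
    (hFsub : F ⊆ (unitsIn q S ×ˢ unitsIn q S).filter
      (fun p : ℕ × ℕ => ((p.1 : ZMod q))⁻¹ + ((p.2 : ZMod q))⁻¹ = s))
    (hF : ∀ p ∈ F, (γ * p.1 - α) * (γ * p.2 - α) = 0) :
    (F.card : ℝ) ≤ 2 * (((B - A : ℕ) : ℝ) / q + 1) := by
  classical
  have hq : 0 < q := Nat.pos_of_ne_zero (NeZero.ne q)
  set P := (unitsIn q S ×ˢ unitsIn q S).filter
      (fun p : ℕ × ℕ => ((p.1 : ZMod q))⁻¹ + ((p.2 : ZMod q))⁻¹ = s) with hP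
  -- the two halves
  have h1 : (((P.filter (fun p : ℕ × ℕ => γ * p.1 = α)).card : ℕ) : ℝ) ≤ ((B - A : ℕ) : ℝ) / q + 1 := by
    have heq : (P.filter (fun p : ℕ × ℕ => γ * p.1 = α)).card =
        ∑ v₁ ∈ (unitsIn q S).filter (fun v : ℕ => γ * v = α),
          ((unitsIn q S).filter (fun v₂ : ℕ => ((v₂ : ZMod q))⁻¹ = s - ((v₁ : ZMod q))⁻¹)).card := by
      rw [hP, Finset.filter_filter, Finset.card_filter, Finset.sum_product, Finset.sum_filter]
      refine Finset.sum_congr rfl fun v₁ _ => ?_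
      split_ifs with hv
      · rw [Finset.card_filter]
        refine Finset.sum_congr rfl fun v₂ _ => ?_
        have : (((v₁ : ZMod q))⁻¹ + ((v₂ : ZMod q))⁻¹ = s ∧ γ * (v₁ : ℤ) = α) ↔
            (((v₂ : ZMod q))⁻¹ = s - ((v₁ : ZMod q))⁻¹) := by
          constructor
          · rintro ⟨h, _⟩; rw [← h]; ring
          · intro h; exact ⟨by rw [h]; ring, hv⟩
        simp only [this]
      · refine Finset.sum_eq_zero fun v₂ _ => ?_
        rw [if_neg (fun h => hv h.2)]
    rw [heq, Nat.cast_sum]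
    calc ∑ v₁ ∈ (unitsIn q S).filter (fun v : ℕ => γ * v = α),
          ((((unitsIn q S).filter (fun v₂ : ℕ => ((v₂ : ZMod q))⁻¹ = s - ((v₁ : ZMod q))⁻¹)).card
            : ℕ) : ℝ)
        ≤ ∑ _v₁ ∈ (unitsIn q S).filter (fun v : ℕ => γ * v = α), (((B - A : ℕ) : ℝ) / q + 1) :=
          Finset.sum_le_sum fun v₁ _ => card_unitsIn_filter_inv_eq_le hq hS _
      _ = (((unitsIn q S).filter (fun v : ℕ => γ * v = α)).card : ℝ) * (((B - A : ℕ) : ℝ) / q + 1) := by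
          rw [Finset.sum_const, nsmul_eq_mul]
      _ ≤ 1 * (((B - A : ℕ) : ℝ) / q + 1) := by
          apply mul_le_mul_of_nonneg_right _ (by positivity)
          exact_mod_cast card_filter_mul_eq_le_one hγ _
      _ = ((B - A : ℕ) : ℝ) / q + 1 := one_mul _
  have h2 : (((P.filter (fun p : ℕ × ℕ => γ * p.2 = α)).card : ℕ) : ℝ) ≤ ((B - A : ℕ) : ℝ) / q + 1 := by
    have heq : (P.filter (fun p : ℕ × ℕ => γ * p.2 = α)).card =
        ∑ v₂ ∈ (unitsIn q S).filter (fun v : ℕ => γ * v = α),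
          ((unitsIn q S).filter (fun v₁ : ℕ => ((v₁ : ZMod q))⁻¹ = s - ((v₂ : ZMod q))⁻¹)).card := by
      rw [hP, Finset.filter_filter, Finset.card_filter, Finset.sum_product, Finset.sum_comm,
        Finset.sum_filter]
      refine Finset.sum_congr rfl fun v₂ _ => ?_
      split_ifs with hv
      · rw [Finset.card_filter]
        refine Finset.sum_congr rfl fun v₁ _ => ?_
        have : (((v₁ : ZMod q))⁻¹ + ((v₂ : ZMod q))⁻¹ = s ∧ γ * (v₂ : ℤ) = α) ↔
            (((v₁ : ZMod q))⁻¹ = s - ((v₂ : ZMod q))⁻¹) := by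
          constructor
          · rintro ⟨h, _⟩; rw [← h]; ring
          · intro h; exact ⟨by rw [h]; ring, hv⟩
        simp only [this]
      · refine Finset.sum_eq_zero fun v₁ _ => ?_
        rw [if_neg (fun h => hv h.2)]
    rw [heq, Nat.cast_sum]
    calc ∑ v₂ ∈ (unitsIn q S).filter (fun v : ℕ => γ * v = α),
          ((((unitsIn q S).filter (fun v₁ : ℕ => ((v₁ : ZMod q))⁻¹ = s - ((v₂ : ZMod q))⁻¹)).card
            : ℕ) : ℝ)
        ≤ ∑ _v₂ ∈ (unitsIn q S).filter (fun v : ℕ => γ * v = α), (((B - A : ℕ) : ℝ) / q + 1) :=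
          Finset.sum_le_sum fun v₂ _ => card_unitsIn_filter_inv_eq_le hq hS _
      _ = (((unitsIn q S).filter (fun v : ℕ => γ * v = α)).card : ℝ) * (((B - A : ℕ) : ℝ) / q + 1) := by
          rw [Finset.sum_const, nsmul_eq_mul]
      _ ≤ 1 * (((B - A : ℕ) : ℝ) / q + 1) := by
          apply mul_le_mul_of_nonneg_right _ (by positivity)
          exact_mod_cast card_filter_mul_eq_le_one hγ _
      _ = ((B - A : ℕ) : ℝ) / q + 1 := one_mul _
  -- `F ⊆ (P ∩ {γv₁ = α}) ∪ (P ∩ {γv₂ = α})`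
  have hsub : F ⊆ P.filter (fun p : ℕ × ℕ => γ * p.1 = α) ∪ P.filter (fun p : ℕ × ℕ => γ * p.2 = α) := by
    intro p hp
    have hpP : p ∈ P := hFsub hp
    rcases mul_eq_zero.mp (hF p hp) with h | h
    · exact Finset.mem_union.mpr (Or.inl (Finset.mem_filter.mpr ⟨hpP, by linarith⟩))
    · exact Finset.mem_union.mpr (Or.inr (Finset.mem_filter.mpr ⟨hpP, by linarith⟩))
  calc (F.card : ℝ) ≤ (((P.filter (fun p : ℕ × ℕ => γ * p.1 = α) ∪
        P.filter (fun p : ℕ × ℕ => γ * p.2 = α)).card : ℕ) : ℝ) := by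
        exact_mod_cast Finset.card_le_card hsub
    _ ≤ (((P.filter (fun p : ℕ × ℕ => γ * p.1 = α)).card : ℕ) : ℝ) +
        (((P.filter (fun p : ℕ × ℕ => γ * p.2 = α)).card : ℕ) : ℝ) := by
        exact_mod_cast Finset.card_union_le _ _
    _ ≤ 2 * (((B - A : ℕ) : ℝ) / q + 1) := by linarith

/-- **Dirichlet's approximation for the class `s`** (the data of (6.11)): with `d = (s, q) ≤ q/2` and
`L = min(q/d − 1, ⌊√(qV)⌋)` there are integers `0 < α ≤ L` and `γ ≠ 0`, `|γ| ≤ q/(L + 1)`, with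
`αs ≡ γ (mod q)` (`γ ≠ 0` because `q/d ∤ α`). [cite: HeathBrown1986d3, §6, before (6.11)] -/
theorem exists_dirichlet_data {q : ℕ} [NeZero q] {V : ℝ} (hV : 1 ≤ V) (s : ZMod q)
    (hd : 2 * Nat.gcd s.val q ≤ q) :
    ∃ (L : ℕ) (α γ : ℤ), 1 ≤ L ∧ (L : ℝ) ≤ Real.sqrt (q * V) ∧
      (((L : ℝ) + 1 = q / (Nat.gcd s.val q) ∨ Real.sqrt (q * V) < (L : ℝ) + 1)) ∧
      0 < α ∧ α ≤ L ∧ γ ≠ 0 ∧ |(γ : ℝ)| ≤ q / ((L : ℝ) + 1) ∧ (γ : ZMod q) = (α : ZMod q) * s := by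
  have hq : 0 < q := Nat.pos_of_ne_zero (NeZero.ne q)
  have hqR : (0 : ℝ) < q := by exact_mod_cast hq
  set d : ℕ := Nat.gcd s.val q with hd_def
  have hd0 : 0 < d := Nat.gcd_pos_of_pos_right _ hq
  obtain ⟨q₁, hq₁⟩ : d ∣ q := Nat.gcd_dvd_right _ _
  have hq₁2 : 2 ≤ q₁ := by
    have : d * 2 ≤ d * q₁ := by rw [← hq₁]; omega
    exact Nat.le_of_mul_le_mul_left this hd0
  have hqd : q / d = q₁ := by rw [hq₁, Nat.mul_div_cancel_left _ hd0]
  have hqdR : (q : ℝ) / d = q₁ := by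
    have hdR : (0 : ℝ) < d := by exact_mod_cast hd0
    rw [hq₁, Nat.cast_mul]; field_simp
  have hq1 : (1 : ℝ) ≤ q := by exact_mod_cast hq
  have hqV1 : (1 : ℝ) ≤ Real.sqrt (q * V) := Real.one_le_sqrt.mpr (one_le_mul_of_one_le_of_one_le hq1 hV)
  set L : ℕ := min (q / d - 1) ⌊Real.sqrt (q * V)⌋₊ with hL
  have hL1 : 1 ≤ L := by
    refine le_min ?_ (Nat.le_floor (by simpa using hqV1))
    rw [hqd]; omega
  have hLq : L ≤ q / d - 1 := min_le_left _ _
  have hLs : (L : ℝ) ≤ Real.sqrt (q * V) :=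
    (Nat.cast_le.mpr (min_le_right _ _)).trans (Nat.floor_le (by positivity))
  have hLcase : ((L : ℝ) + 1 = q / d ∨ Real.sqrt (q * V) < (L : ℝ) + 1) := by
    rcases min_cases (q / d - 1) ⌊Real.sqrt (q * V)⌋₊ with ⟨hLeq, _⟩ | ⟨hLeq, _⟩
    · left
      rw [hqdR]
      have : L + 1 = q₁ := by rw [hL, hLeq, hqd]; omega
      exact_mod_cast this
    · right
      rw [hL, hLeq]; exact Nat.lt_floor_add_one _
  -- Dirichlet
  obtain ⟨β, α, hα0, hαL, hαβ⟩ :=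
    Real.exists_int_int_abs_mul_sub_le ((s.val : ℝ) / q) (n := L) (by omega)
  refine ⟨L, α, α * s.val - β * q, hL1, hLs, hLcase, hα0, hαL, ?_, ?_, ?_⟩
  · intro h0
    have h1 : α * (s.val : ℤ) = β * q := by linarith
    obtain ⟨s₁, hs₁⟩ : d ∣ s.val := Nat.gcd_dvd_left _ _
    have hcop : Nat.Coprime s₁ q₁ := by
      have := Nat.coprime_div_gcd_div_gcd (m := s.val) (n := q) hd0
      rw [← hd_def] at this
      rwa [hs₁, hq₁, Nat.mul_div_cancel_left _ hd0, Nat.mul_div_cancel_left _ hd0] at this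
    have h2 : α * (s₁ : ℤ) = β * q₁ := by
      have e1 : ((s.val : ℕ) : ℤ) = d * s₁ := by exact_mod_cast hs₁
      have e2 : ((q : ℕ) : ℤ) = d * q₁ := by exact_mod_cast hq₁
      rw [e1, e2] at h1
      have : (d : ℤ) * (α * s₁) = d * (β * q₁) := by linarith
      exact mul_left_cancel₀ (by exact_mod_cast hd0.ne') this
    have h3 : (q₁ : ℤ) ∣ α * s₁ := ⟨β, by rw [h2]; ring⟩
    have h4 : q₁ ∣ α.natAbs * s₁ := by
      have := Int.natAbs_dvd_natAbs.mpr h3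
      simpa [Int.natAbs_mul] using this
    have h5 : q₁ ∣ α.natAbs := Nat.Coprime.dvd_of_dvd_mul_right hcop.symm h4
    have h6 : q₁ ≤ α.natAbs := Nat.le_of_dvd (Int.natAbs_pos.mpr hα0.ne') h5
    have h7 : (α.natAbs : ℤ) ≤ L := by rw [Int.natAbs_of_nonneg hα0.le]; exact hαL
    have h8 : α.natAbs ≤ L := by exact_mod_cast h7
    omega
  · have hγR : ((α * s.val - β * q : ℤ) : ℝ) = q * (α * ((s.val : ℝ) / q) - β) := by
      push_cast; field_simp
    rw [hγR, abs_mul, abs_of_pos hqR]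
    calc (q : ℝ) * |α * ((s.val : ℝ) / q) - β| ≤ q * (1 / (L + 1)) := by gcongr
      _ = q / (L + 1) := by ring
  · push_cast
    rw [ZMod.natCast_self, mul_zero, sub_zero, ZMod.natCast_zmod_val]

/-- The range of `t` in (6.11): `2(4LV/q + 4V²/(L + 1)) + 3 ≤ 8V²d/q + 16 V√V/√q + 3` for the `L`
of `exists_dirichlet_data`. [folklore] -/
theorem two_mul_tRange_add_three_le {q d L : ℕ} (hq : 0 < q) (hd : 0 < d) (hL1 : 1 ≤ L) {V : ℝ}
    (hV : 1 ≤ V) (hLs : (L : ℝ) ≤ Real.sqrt (q * V))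
    (hLcase : (L : ℝ) + 1 = q / d ∨ Real.sqrt (q * V) < (L : ℝ) + 1) :
    2 * (4 * L * V / q + 4 * V ^ 2 / (L + 1)) + 3 ≤
      8 * V ^ 2 * d / q + 16 * V * Real.sqrt V / Real.sqrt q + 3 := by
  have hqR : (0 : ℝ) < q := by exact_mod_cast hq
  have hdR : (0 : ℝ) < d := by exact_mod_cast hd
  have hV0 : 0 < V := by linarith
  have hsqq : (0 : ℝ) < Real.sqrt q := Real.sqrt_pos.mpr hqR
  have hsqV : (0 : ℝ) < Real.sqrt V := Real.sqrt_pos.mpr hV0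
  have e1 : Real.sqrt (q * V) = Real.sqrt q * Real.sqrt V := Real.sqrt_mul hqR.le V
  have e2 : (q : ℝ) = Real.sqrt q * Real.sqrt q := (Real.mul_self_sqrt hqR.le).symm
  have eV : V = Real.sqrt V * Real.sqrt V := (Real.mul_self_sqrt hV0.le).symm
  -- `4LV/q ≤ 4 V√V/√q`
  have ha : 4 * L * V / q ≤ 4 * V * Real.sqrt V / Real.sqrt q := by
    rw [div_le_div_iff₀ hqR hsqq]
    calc 4 * (L : ℝ) * V * Real.sqrt q ≤ 4 * (Real.sqrt q * Real.sqrt V) * V * Real.sqrt q := by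
          rw [← e1]; gcongr
      _ = 4 * V * Real.sqrt V * (Real.sqrt q * Real.sqrt q) := by ring
      _ = 4 * V * Real.sqrt V * q := by rw [← e2]
  -- `4V²/(L+1) ≤ 4V²d/q + 4V√V/√q`
  have hb : 4 * V ^ 2 / (L + 1) ≤ 4 * V ^ 2 * d / q + 4 * V * Real.sqrt V / Real.sqrt q := by
    have hpos1 : 0 ≤ 4 * V ^ 2 * d / q := by positivity
    have hpos2 : 0 ≤ 4 * V * Real.sqrt V / Real.sqrt q := by positivity
    rcases hLcase with hL' | hL'
    · rw [hL']
      have : 4 * V ^ 2 / ((q : ℝ) / d) = 4 * V ^ 2 * d / q := by field_simp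
      rw [this]; linarith
    · have : 4 * V ^ 2 / ((L : ℝ) + 1) ≤ 4 * V * Real.sqrt V / Real.sqrt q := by
        rw [div_le_div_iff₀ (by positivity) hsqq]
        calc 4 * V ^ 2 * Real.sqrt q = 4 * V * (Real.sqrt V * Real.sqrt V) * Real.sqrt q := by
              rw [Real.mul_self_sqrt hV0.le]; ring
          _ = 4 * V * Real.sqrt V * (Real.sqrt q * Real.sqrt V) := by ring
          _ ≤ 4 * V * Real.sqrt V * ((L : ℝ) + 1) := by rw [← e1]; gcongr
      linarith
  have hsum := add_le_add ha hb
  calc 2 * (4 * L * V / q + 4 * V ^ 2 / (L + 1)) + 3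
      ≤ 2 * (4 * V * Real.sqrt V / Real.sqrt q +
          (4 * V ^ 2 * d / q + 4 * V * Real.sqrt V / Real.sqrt q)) + 3 := by linarith
    _ = 8 * V ^ 2 * d / q + 16 * V * Real.sqrt V / Real.sqrt q + 3 := by ring

/-- The size of `N = α² − γqt` in (6.11): `|N| ≤ 9q³V²`. [folklore] -/
theorem abs_dirichlet_N_le {q : ℕ} (hq : 0 < q) {L : ℕ} (hL1 : 1 ≤ L) {V : ℝ} (hV : 1 ≤ V)
    (hLs : (L : ℝ) ≤ Real.sqrt (q * V)) {α γ t : ℤ} (hα0 : 0 < α) (hαL : α ≤ L)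
    (hγabs : |(γ : ℝ)| ≤ q / ((L : ℝ) + 1))
    (ht : |(t : ℝ)| ≤ (4 * L * V / q + 4 * V ^ 2 / (L + 1)) + 1) :
    |((α : ℝ) ^ 2 - γ * q * t)| ≤ 9 * (q : ℝ) ^ 3 * V ^ 2 := by
  have hqR : (0 : ℝ) < q := by exact_mod_cast hq
  have hq1 : (1 : ℝ) ≤ q := by exact_mod_cast hq
  have hV0 : 0 < V := by linarith
  have hLR1 : (1 : ℝ) ≤ L := by exact_mod_cast hL1
  have hαRL : (α : ℝ) ≤ L := by exact_mod_cast hαL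
  have hsq : Real.sqrt (q * V) ≤ q * V := by
    have hsq' : q * V ≤ (q * V) ^ 2 := by
      have h1 : (1 : ℝ) ≤ q * V := one_le_mul_of_one_le_of_one_le hq1 hV
      calc (q : ℝ) * V = (q * V) * 1 := by ring
        _ ≤ (q * V) * (q * V) := by gcongr
        _ = (q * V) ^ 2 := by ring
    calc Real.sqrt (q * V) ≤ Real.sqrt ((q * V) ^ 2) := Real.sqrt_le_sqrt hsq'
      _ = q * V := Real.sqrt_sq (by positivity)
  have ha : 4 * L * V / q ≤ 4 * V ^ 2 := by
    rw [div_le_iff₀ hqR]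
    have : (L : ℝ) * V ≤ (q * V) * V := mul_le_mul_of_nonneg_right (hLs.trans hsq) hV0.le
    linarith
  have hb : 4 * V ^ 2 / (L + 1) ≤ 2 * V ^ 2 := by
    rw [div_le_iff₀ (by positivity)]
    have : V ^ 2 * 1 ≤ V ^ 2 * (L : ℝ) := mul_le_mul_of_nonneg_left hLR1 (by positivity)
    linarith
  have hV2 : (1 : ℝ) ≤ V ^ 2 := one_le_pow₀ hV
  have ht7 : |(t : ℝ)| ≤ 7 * V ^ 2 := by linarith
  have hα2 : (α : ℝ) ^ 2 ≤ q * V := by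
    have : (α : ℝ) ≤ Real.sqrt (q * V) := hαRL.trans hLs
    have hα0R : (0 : ℝ) ≤ α := by exact_mod_cast hα0.le
    calc (α : ℝ) ^ 2 ≤ (Real.sqrt (q * V)) ^ 2 := by gcongr
      _ = q * V := Real.sq_sqrt (by positivity)
  have hγ' : |(γ : ℝ)| ≤ q := by
    refine hγabs.trans ?_
    rw [div_le_iff₀ (by positivity)]
    have : (q : ℝ) * 1 ≤ q * ((L : ℝ) + 1) := mul_le_mul_of_nonneg_left (by linarith) hqR.le
    linarith
  calc |((α : ℝ) ^ 2 - γ * q * t)| ≤ |(α : ℝ) ^ 2| + |(γ : ℝ) * q * t| := abs_sub _ _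
    _ = (α : ℝ) ^ 2 + |(γ : ℝ)| * q * |(t : ℝ)| := by
        rw [abs_of_nonneg (by positivity), abs_mul, abs_mul, abs_of_pos hqR]
    _ ≤ q * V + q * q * (7 * V ^ 2) := by
        apply add_le_add hα2
        calc |(γ : ℝ)| * q * |(t : ℝ)| = (|(γ : ℝ)| * q) * |(t : ℝ)| := by ring
          _ ≤ (q * q) * (7 * V ^ 2) :=
              mul_le_mul (mul_le_mul_of_nonneg_right hγ' hqR.le) ht7 (abs_nonneg _) (by positivity)
    _ ≤ 9 * (q : ℝ) ^ 3 * V ^ 2 := by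
        have e1 : (q : ℝ) * V ≤ (q : ℝ) ^ 3 * V ^ 2 := by
          have h1 : (1 : ℝ) ≤ (q : ℝ) ^ 2 * V := one_le_mul_of_one_le_of_one_le (one_le_pow₀ hq1) hV
          calc (q : ℝ) * V = (q * V) * 1 := by ring
            _ ≤ (q * V) * ((q : ℝ) ^ 2 * V) := by gcongr
            _ = (q : ℝ) ^ 3 * V ^ 2 := by ring
        have e2 : (q : ℝ) * q * (7 * V ^ 2) ≤ 7 * ((q : ℝ) ^ 3 * V ^ 2) := by
          have h1 : (q : ℝ) ^ 2 ≤ (q : ℝ) ^ 3 := pow_le_pow_right₀ hq1 (by norm_num)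
          calc (q : ℝ) * q * (7 * V ^ 2) = 7 * V ^ 2 * (q : ℝ) ^ 2 := by ring
            _ ≤ 7 * V ^ 2 * (q : ℝ) ^ 3 := by gcongr
            _ = 7 * ((q : ℝ) ^ 3 * V ^ 2) := by ring
        linarith

/-- **(6.11), Heath-Brown's Dirichlet-approximation step**: for `𝒥 ⊆ (A, B] ⊂ (0, 2V]`, `V ≥ 1`,
and a class `s` with `d = (s, q) ≤ q/2`,
`m(s) ≤ (8V²d/q + 16 V^{3/2} q^{−1/2} + 3)(2M + 2((B − A)/q + 1))`, `M` any bound for `d(n)`,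
`1 ≤ n ≤ 9q³V²`: with `sα ≡ γ (mod q)`, `0 < α ≤ L`, `0 < |γ| ≤ q/(L + 1)` (`exists_dirichlet_data`),
every pair has `α(v₁ + v₂) = γv₁v₂ + qt`, `|t| ≤ 4LV/q + 4V²/(L + 1)`, and for each `t` either
`(γv₁ − α)(γv₂ − α) = α² − γqt ≠ 0` has at most `2 d(|α² − γqt|)` solutions, or one of the `vᵢ` is
`α/γ` and the other lies in one class `mod q`. [cite: HeathBrown1986d3, §6 (6.11)] -/
theorem invPairCount_le_of_gcd {q : ℕ} [NeZero q] {S : Finset ℕ} {A B : ℕ} (hS : S ⊆ Ioc A B)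
    {V : ℝ} (hV : 1 ≤ V) (hBV : (B : ℝ) ≤ 2 * V) (s : ZMod q) (hd : 2 * Nat.gcd s.val q ≤ q)
    {M : ℝ} (hM : ∀ n : ℕ, n ≠ 0 → (n : ℝ) ≤ 9 * (q : ℝ) ^ 3 * V ^ 2 → (n.divisors.card : ℝ) ≤ M) :
    ((invPairCount q S s : ℕ) : ℝ) ≤
      (8 * V ^ 2 * (Nat.gcd s.val q) / q + 16 * V * Real.sqrt V / Real.sqrt q + 3) *
        (2 * M + 2 * (((B - A : ℕ) : ℝ) / q + 1)) := by
  classical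
  have hq : 0 < q := Nat.pos_of_ne_zero (NeZero.ne q)
  have hMnn : 0 ≤ M := (Nat.cast_nonneg _).trans (hM 1 one_ne_zero (by
    have : (1:ℝ) ≤ q := by exact_mod_cast hq
    have h1 : (1 : ℝ) ≤ (q : ℝ) ^ 3 := one_le_pow₀ this
    have h2 : (1 : ℝ) ≤ V ^ 2 := one_le_pow₀ hV
    push_cast; nlinarith))
  have hqR : (0 : ℝ) < q := by exact_mod_cast hq
  have hV0 : 0 < V := by linarith
  have hd0 : 0 < Nat.gcd s.val q := Nat.gcd_pos_of_pos_right _ hq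
  obtain ⟨L, α, γ, hL1, hLs, hLcase, hα0, hαL, hγ0, hγabs, hγq⟩ := exists_dirichlet_data hV s hd
  have hαR0 : (0 : ℝ) < α := by exact_mod_cast hα0
  have hαRL : (α : ℝ) ≤ L := by exact_mod_cast hαL
  -- the pairs and the quotient `t`
  set F := (unitsIn q S ×ˢ unitsIn q S).filter
      (fun p : ℕ × ℕ => ((p.1 : ZMod q))⁻¹ + ((p.2 : ZMod q))⁻¹ = s) with hF
  have hFcard : invPairCount q S s = F.card := rfl
  set tf : ℕ × ℕ → ℤ := fun p => (α * ((p.1 : ℤ) + p.2) - γ * ((p.1 : ℤ) * p.2)) / q with htf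
  have htq : ∀ p ∈ F, (q : ℤ) * tf p = α * ((p.1 : ℤ) + p.2) - γ * ((p.1 : ℤ) * p.2) := by
    intro p hp
    rw [hF, Finset.mem_filter, Finset.mem_product] at hp
    exact Int.mul_ediv_cancel' (dvd_of_inv_add_inv_eq (isUnit_of_mem_unitsIn hp.1.1)
      (isUnit_of_mem_unitsIn hp.1.2) hp.2 hγq)
  have hvB : ∀ v ∈ unitsIn q S, (v : ℝ) ≤ 2 * V := fun v hv => by
    have := (Finset.mem_Ioc.mp (hS (mem_unitsIn.mp hv).1)).2
    have : (v : ℝ) ≤ B := by exact_mod_cast this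
    linarith
  -- `|t| ≤ T₀`
  set T₀ : ℝ := 4 * L * V / q + 4 * V ^ 2 / (L + 1) with hT₀
  have hT₀0 : 0 ≤ T₀ := by positivity
  have htbound : ∀ p ∈ F, |(tf p : ℝ)| ≤ T₀ := by
    intro p hp
    have hp' := hp
    rw [hF, Finset.mem_filter, Finset.mem_product] at hp'
    have h1 := hvB _ hp'.1.1
    have h2 := hvB _ hp'.1.2
    have h1' : (0 : ℝ) ≤ p.1 := Nat.cast_nonneg _
    have h2' : (0 : ℝ) ≤ p.2 := Nat.cast_nonneg _
    have e : (q : ℝ) * (tf p : ℝ) = α * ((p.1 : ℝ) + p.2) - γ * ((p.1 : ℝ) * p.2) := by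
      exact_mod_cast htq p hp
    have hprod : (p.1 : ℝ) * p.2 ≤ (2 * V) * (2 * V) := mul_le_mul h1 h2 h2' (by linarith)
    have hmain : |(q : ℝ) * tf p| ≤ L * (4 * V) + q / (L + 1) * (4 * V ^ 2) := by
      rw [e]
      calc |(α : ℝ) * ((p.1 : ℝ) + p.2) - γ * ((p.1 : ℝ) * p.2)|
          ≤ |(α : ℝ) * ((p.1 : ℝ) + p.2)| + |(γ : ℝ) * ((p.1 : ℝ) * p.2)| := abs_sub _ _
        _ = α * ((p.1 : ℝ) + p.2) + |(γ : ℝ)| * ((p.1 : ℝ) * p.2) := by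
            rw [abs_of_nonneg (by positivity), abs_mul, abs_of_nonneg (mul_nonneg h1' h2')]
        _ ≤ L * (4 * V) + q / (L + 1) * (4 * V ^ 2) := by
            apply add_le_add
            · exact mul_le_mul hαRL (by linarith) (by positivity) (by positivity)
            · exact mul_le_mul hγabs (by linarith) (by positivity) (by positivity)
    rw [abs_mul, abs_of_pos hqR] at hmain
    have : |(tf p : ℝ)| ≤ (L * (4 * V) + q / (L + 1) * (4 * V ^ 2)) / q := by
      rw [le_div_iff₀ hqR]; linarith
    calc |(tf p : ℝ)| ≤ (L * (4 * V) + q / (L + 1) * (4 * V ^ 2)) / q := this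
      _ = T₀ := by rw [hT₀]; field_simp
  -- decomposition along `t ∈ [-T, T]`
  set T : ℤ := ⌈T₀⌉ with hT
  have hT0 : 0 ≤ T := Int.ceil_nonneg hT₀0
  have hTle : (T : ℝ) ≤ T₀ + 1 := (Int.ceil_lt_add_one T₀).le
  have hmaps : Set.MapsTo tf (F : Set (ℕ × ℕ)) ((Finset.Icc (-T) T : Finset ℤ) : Set ℤ) := by
    intro p hp
    have hb := abs_le.mp (htbound p (Finset.mem_coe.mp hp))
    have hT' : T₀ ≤ T := Int.le_ceil T₀
    rw [Finset.mem_coe, Finset.mem_Icc]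
    constructor
    · have : ((-T : ℤ) : ℝ) ≤ tf p := by push_cast; linarith
      exact_mod_cast this
    · have : (tf p : ℝ) ≤ T := by linarith
      exact_mod_cast this
  have hdecomp := Finset.card_eq_sum_card_fiberwise hmaps
  -- each fibre
  have hfiber : ∀ t ∈ Finset.Icc (-T) T,
      (((F.filter (fun p => tf p = t)).card : ℕ) : ℝ) ≤ 2 * M + 2 * (((B - A : ℕ) : ℝ) / q + 1) := by
    intro t ht
    have hB0 : (0 : ℝ) ≤ 2 * (((B - A : ℕ) : ℝ) / q + 1) := by positivity
    have hM0 : (0 : ℝ) ≤ 2 * M := by linarith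
    set N : ℤ := α ^ 2 - γ * q * t with hN
    have hprod : ∀ p ∈ F.filter (fun p => tf p = t), (γ * p.1 - α) * (γ * p.2 - α) = N := by
      intro p hp
      rw [Finset.mem_filter] at hp
      have e := htq p hp.1
      rw [hp.2] at e
      rw [hN]
      linear_combination γ * e
    by_cases hN0 : N = 0
    · have h := card_le_of_mul_eq_zero hS s hγ0 (F.filter (fun p => tf p = t))
        (by rw [hF]; exact Finset.filter_subset _ _) (fun p hp => by rw [hprod p hp, hN0])
      linarith
    · have h1 := card_le_two_mul_card_divisors hγ0 hN0 (F.filter (fun p => tf p = t)) hprod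
      have htabs : |(t : ℝ)| ≤ T₀ + 1 := by
        rw [Finset.mem_Icc] at ht
        rw [abs_le]
        constructor
        · have : ((-T : ℤ) : ℝ) ≤ t := by exact_mod_cast ht.1
          push_cast at this; linarith
        · have : (t : ℝ) ≤ T := by exact_mod_cast ht.2
          linarith
      have hNabs : ((N.natAbs : ℕ) : ℝ) ≤ 9 * (q : ℝ) ^ 3 * V ^ 2 := by
        rw [Nat.cast_natAbs, Int.cast_abs]
        have e : ((N : ℤ) : ℝ) = (α : ℝ) ^ 2 - γ * q * t := by rw [hN]; push_cast; ring
        rw [e]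
        exact abs_dirichlet_N_le hq hL1 hV hLs hα0 hαL hγabs (by rw [hT₀] at htabs; exact htabs)
      have h2 := hM N.natAbs (Int.natAbs_ne_zero.mpr hN0) hNabs
      have h1' : (((F.filter (fun p => tf p = t)).card : ℕ) : ℝ) ≤ 2 * (N.natAbs.divisors.card : ℝ) := by
        exact_mod_cast h1
      linarith
  -- summation over `t`
  have hcount : (((Finset.Icc (-T) T).card : ℕ) : ℝ) ≤ 2 * T₀ + 3 := by
    rw [Int.card_Icc, show T + 1 - -T = 2 * T + 1 by ring]
    have h0 : (0 : ℤ) ≤ 2 * T + 1 := by linarith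
    have : (((2 * T + 1).toNat : ℕ) : ℝ) = ((2 * T + 1 : ℤ) : ℝ) := by
      exact_mod_cast Int.toNat_of_nonneg h0
    rw [this]; push_cast; linarith
  have hT₀bound : 2 * T₀ + 3 ≤
      8 * V ^ 2 * (Nat.gcd s.val q) / q + 16 * V * Real.sqrt V / Real.sqrt q + 3 := by
    rw [hT₀]; exact two_mul_tRange_add_three_le hq hd0 hL1 hV hLs hLcase
  -- assemble
  rw [hFcard, hdecomp, Nat.cast_sum]
  calc ∑ t ∈ Finset.Icc (-T) T, (((F.filter (fun p => tf p = t)).card : ℕ) : ℝ)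
      ≤ ∑ _t ∈ Finset.Icc (-T) T, (2 * (M : ℝ) + 2 * (((B - A : ℕ) : ℝ) / q + 1)) :=
        Finset.sum_le_sum hfiber
    _ = (((Finset.Icc (-T) T).card : ℕ) : ℝ) * (2 * M + 2 * (((B - A : ℕ) : ℝ) / q + 1)) := by
        rw [Finset.sum_const, nsmul_eq_mul]
    _ ≤ (8 * V ^ 2 * (Nat.gcd s.val q) / q + 16 * V * Real.sqrt V / Real.sqrt q + 3) *
        (2 * M + 2 * (((B - A : ℕ) : ℝ) / q + 1)) :=
        mul_le_mul_of_nonneg_right (hcount.trans hT₀bound) (by positivity)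

/-! ### Summation over the classes: (6.10), (6.12), (6.13) -/

/-- The per-divisor bound in (6.12) (small `d`): pure bookkeeping. [cite: HeathBrown1986d3, §6 (6.12)] -/
theorem perDivisor_le_of_small {V q J M a cS d : ℝ} (hV : 1 ≤ V) (hq : 0 < q) (hJ : 1 ≤ J) (hM : 0 ≤ M)
    (ha0 : 0 ≤ a) (haJ : a ≤ J) (haq : a / q + 1 ≤ 2) (hcS0 : 0 ≤ cS) (hcS : cS ≤ J) (hd1 : 1 ≤ d)
    (hdD : d ≤ 1 + Real.sqrt q * J / V) :
    (8 * V ^ 2 * d / q + 16 * V * Real.sqrt V / Real.sqrt q + 3) * (2 * M + 2 * (a / q + 1)) *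
        (cS * (a / d + 1)) ≤
      62 * (2 * M + 4) * J ^ 2 * (1 + V ^ 2 / q + V * Real.sqrt V / Real.sqrt q) := by
  have hV0 : 0 < V := by linarith
  have hd0 : 0 < d := by linarith
  have hsq : 0 < Real.sqrt q := Real.sqrt_pos.mpr hq
  have hsV1 : 1 ≤ Real.sqrt V := Real.one_le_sqrt.mpr hV
  have hs2 : Real.sqrt q * Real.sqrt q = q := Real.mul_self_sqrt hq.le
  set P : ℝ := 1 + V ^ 2 / q + V * Real.sqrt V / Real.sqrt q with hP
  have hnn1 : 0 ≤ V ^ 2 / q := by positivity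
  have hnn2 : 0 ≤ V * Real.sqrt V / Real.sqrt q := by positivity
  have hP1 : V ^ 2 / q ≤ P := by rw [hP]; linarith
  have hP2 : V * Real.sqrt V / Real.sqrt q ≤ P := by rw [hP]; linarith
  have hP3 : 1 ≤ P := by rw [hP]; linarith
  have hP0 : 0 ≤ P := by linarith
  have hJ2 : J ≤ J ^ 2 := by nlinarith
  -- Step A
  have hA1 : 2 * M + 2 * (a / q + 1) ≤ 2 * M + 4 := by linarith
  have hA2 : cS * (a / d + 1) ≤ J * (J / d + 1) := by
    apply mul_le_mul hcS _ (by positivity) (by positivity)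
    gcongr
  have hfac0 : 0 ≤ 8 * V ^ 2 * d / q + 16 * V * Real.sqrt V / Real.sqrt q + 3 := by positivity
  -- Step B: the bracket
  have hT1 : (8 * V ^ 2 * d / q) * (J * (J / d + 1)) ≤ 24 * J ^ 2 * P := by
    have e1 : (8 * V ^ 2 * d / q) * (J * (J / d + 1)) = 8 * V ^ 2 * J ^ 2 / q + 8 * V ^ 2 * J * d / q := by
      field_simp
    have e2 : 8 * V ^ 2 * J * d / q ≤ 8 * V ^ 2 * J / q + 8 * V * J ^ 2 / Real.sqrt q := by
      calc 8 * V ^ 2 * J * d / q ≤ 8 * V ^ 2 * J * (1 + Real.sqrt q * J / V) / q := by gcongr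
        _ = 8 * V ^ 2 * J / q + 8 * V * J ^ 2 * (Real.sqrt q / q) := by field_simp
        _ = 8 * V ^ 2 * J / q + 8 * V * J ^ 2 / Real.sqrt q := by
            have : Real.sqrt q / q = 1 / Real.sqrt q := by
              rw [div_eq_div_iff hq.ne' hsq.ne']; linarith [hs2]
            rw [this]; ring
    have e3 : 8 * V ^ 2 * J / q ≤ 8 * J ^ 2 * (V ^ 2 / q) := by
      have : 8 * V ^ 2 * J / q = 8 * J * (V ^ 2 / q) := by ring
      rw [this]; gcongr
    have e4 : 8 * V * J ^ 2 / Real.sqrt q ≤ 8 * J ^ 2 * (V * Real.sqrt V / Real.sqrt q) := by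
      have : 8 * V * J ^ 2 / Real.sqrt q = 8 * J ^ 2 * (V * 1 / Real.sqrt q) := by ring
      rw [this]; gcongr
    have e5 : 8 * V ^ 2 * J ^ 2 / q = 8 * J ^ 2 * (V ^ 2 / q) := by ring
    calc (8 * V ^ 2 * d / q) * (J * (J / d + 1))
        = 8 * V ^ 2 * J ^ 2 / q + 8 * V ^ 2 * J * d / q := e1
      _ ≤ 8 * J ^ 2 * (V ^ 2 / q) + (8 * J ^ 2 * (V ^ 2 / q) + 8 * J ^ 2 * (V * Real.sqrt V / Real.sqrt q)) := by
          rw [e5]; linarith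
      _ ≤ 8 * J ^ 2 * P + (8 * J ^ 2 * P + 8 * J ^ 2 * P) := by gcongr
      _ = 24 * J ^ 2 * P := by ring
  have hT2 : (16 * V * Real.sqrt V / Real.sqrt q + 3) * (J * (J / d + 1)) ≤ 38 * J ^ 2 * P := by
    have e1 : J * (J / d + 1) ≤ 2 * J ^ 2 := by
      have : J / d ≤ J := div_le_self (by linarith) hd1
      nlinarith
    calc (16 * V * Real.sqrt V / Real.sqrt q + 3) * (J * (J / d + 1))
        ≤ (16 * V * Real.sqrt V / Real.sqrt q + 3) * (2 * J ^ 2) := by gcongr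
      _ = 32 * J ^ 2 * (V * Real.sqrt V / Real.sqrt q) + 6 * J ^ 2 * 1 := by ring
      _ ≤ 32 * J ^ 2 * P + 6 * J ^ 2 * P := by gcongr
      _ = 38 * J ^ 2 * P := by ring
  have hB : (8 * V ^ 2 * d / q + 16 * V * Real.sqrt V / Real.sqrt q + 3) * (J * (J / d + 1)) ≤
      62 * J ^ 2 * P := by
    have := add_le_add hT1 hT2
    calc (8 * V ^ 2 * d / q + 16 * V * Real.sqrt V / Real.sqrt q + 3) * (J * (J / d + 1))
        = (8 * V ^ 2 * d / q) * (J * (J / d + 1)) +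
          (16 * V * Real.sqrt V / Real.sqrt q + 3) * (J * (J / d + 1)) := by ring
      _ ≤ 24 * J ^ 2 * P + 38 * J ^ 2 * P := this
      _ = 62 * J ^ 2 * P := by ring
  -- combine
  calc (8 * V ^ 2 * d / q + 16 * V * Real.sqrt V / Real.sqrt q + 3) * (2 * M + 2 * (a / q + 1)) *
        (cS * (a / d + 1))
      ≤ (8 * V ^ 2 * d / q + 16 * V * Real.sqrt V / Real.sqrt q + 3) * (2 * M + 4) *
        (J * (J / d + 1)) := by
        apply mul_le_mul (mul_le_mul_of_nonneg_left hA1 hfac0) hA2 (by positivity) (by positivity)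
    _ = (2 * M + 4) * ((8 * V ^ 2 * d / q + 16 * V * Real.sqrt V / Real.sqrt q + 3) *
        (J * (J / d + 1))) := by ring
    _ ≤ (2 * M + 4) * (62 * J ^ 2 * P) := by gcongr
    _ = 62 * (2 * M + 4) * J ^ 2 * P := by ring

/-- The per-divisor bound in (6.10)/(6.12) (large `d`): pure bookkeeping. [cite: HeathBrown1986d3, §6 (6.10)] -/
theorem perDivisor_le_of_large {V q J M a cS d D₀ : ℝ} (hV : 1 ≤ V) (hq : 0 < q) (hJ : 1 ≤ J)
    (hJq : J ≤ q) (hM : 0 ≤ M) (ha0 : 0 ≤ a) (haJ : a ≤ J) (haq : a / q + 1 ≤ 2) (hcS0 : 0 ≤ cS)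
    (hcS : cS ≤ J) (hd0 : 0 < d) (hD₀ : Real.sqrt q * J / V < D₀) (hcase : D₀ < d ∨ q < 2 * d) :
    cS * (a / q + 1) * (cS * (a / d + 1)) ≤
      62 * (2 * M + 4) * J ^ 2 * (1 + V ^ 2 / q + V * Real.sqrt V / Real.sqrt q) := by
  have hV0 : 0 < V := by linarith
  have hsq : 0 < Real.sqrt q := Real.sqrt_pos.mpr hq
  have hsV1 : 1 ≤ Real.sqrt V := Real.one_le_sqrt.mpr hV
  set P : ℝ := 1 + V ^ 2 / q + V * Real.sqrt V / Real.sqrt q with hP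
  have hnn1 : 0 ≤ V ^ 2 / q := by positivity
  have hnn2 : 0 ≤ V * Real.sqrt V / Real.sqrt q := by positivity
  have hP2 : V * Real.sqrt V / Real.sqrt q ≤ P := by rw [hP]; linarith
  have hP3 : 1 ≤ P := by rw [hP]; linarith
  have hP0 : 0 ≤ P := by linarith
  have h1 : cS * (a / q + 1) ≤ 2 * J := by nlinarith
  have h2 : cS * (a / d + 1) ≤ J * (J / d + 1) := by
    apply mul_le_mul hcS _ (by positivity) (by positivity)
    gcongr
  -- `J/d ≤ 2P`
  have h3 : J / d ≤ 2 * P := by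
    rcases hcase with hc | hc
    · -- `J/d < V/√q ≤ P`
      have hJd : J / d ≤ V / Real.sqrt q := by
        have hlt : Real.sqrt q * J / V < d := hD₀.trans hc
        rw [div_le_div_iff₀ hd0 hsq]
        have := (div_lt_iff₀ hV0).mp hlt
        nlinarith
      have hVP : V / Real.sqrt q ≤ V * Real.sqrt V / Real.sqrt q := by
        apply div_le_div_of_nonneg_right _ hsq.le
        nlinarith
      linarith
    · -- `J/d < 2J/q ≤ 2`
      have hJd : J / d ≤ 2 := by
        rw [div_le_iff₀ hd0]; nlinarith
      linarith
  calc cS * (a / q + 1) * (cS * (a / d + 1)) ≤ (2 * J) * (J * (J / d + 1)) :=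
        mul_le_mul h1 h2 (by positivity) (by positivity)
    _ ≤ (2 * J) * (J * (2 * P + 1)) := by gcongr
    _ ≤ (2 * J) * (J * (3 * P)) := by gcongr; linarith
    _ = 6 * 1 * J ^ 2 * P := by ring
    _ ≤ 62 * (2 * M + 4) * J ^ 2 * P := by gcongr <;> linarith

set_option maxHeartbeats 400000 in
/-- **Heath-Brown's bound for the additive energy of the modular inverses of an interval**
(Acta Arith. 47 (1986), §6, (6.13)): for every `ε > 0` there is `C = C(ε)` such that for `q ≥ 1`,
`V ≥ 1`, an interval `(A, B] ⊆ (V, 2V]` (i.e. `V ≤ A`, `B ≤ 2V`) and any `𝒥 ⊆ (A, B]`,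
`H(𝒥, q) = #{v₁,…,v₄ ∈ 𝒥, (vᵢ, q) = 1 : v̄₁ + v̄₂ ≡ v̄₃ + v̄₄ (mod q)}`
`≤ C (qV)^ε d(q) J² (1 + V²/q + V^{3/2} q^{−1/2})`, `J = (B − A) + 1`
("`H(𝒥, q) ≪ X^ε d(q) J² (1 + V² q⁻¹ + V^{3/2} q^{−1/2})`", (6.13), for `𝒥 = (V, ζV]`; the proof,
(6.6)–(6.12), only uses `𝒥 ⊆ (V, 2V]`, and the count is monotone in `𝒥`).  Proof as printed: the trivial
bound (6.8) when `J > q`; otherwise split `H = ∑_s m(s)²` according to `d = (s, q)`: for `d > D₀` or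
`d > q/2` use `m(s) ≤ 2J` and (6.9), for `d ≤ min(D₀, q/2)` use (6.11) (`invPairCount_le_of_gcd`) and
(6.9), with `D₀ = 1 + ⌊q^{1/2} J/V⌋` and the divisor bound `d(n) ≤ C_τ n^{ε/3}` for `n ≤ 9q³V²`.
[cite: HeathBrown1986d3, §6 (6.13)] -/
theorem invEnergy_le {ε : ℝ} (hε : 0 < ε) :
    ∃ C : ℝ, 0 < C ∧ ∀ (q : ℕ) [NeZero q] (V : ℝ) (A B : ℕ) (S : Finset ℕ),
      1 ≤ V → V ≤ (A : ℝ) → (B : ℝ) ≤ 2 * V → S ⊆ Ioc A B →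
      ((invEnergy q S : ℕ) : ℝ) ≤ C * ((q : ℝ) * V) ^ ε * (Nat.divisors q).card *
        ((((B - A : ℕ) : ℝ) + 1) ^ 2 * (1 + V ^ 2 / q + V * Real.sqrt V / Real.sqrt q)) := by
  obtain ⟨Cτ, hCτ1, hCτ⟩ := exists_card_divisors_le_mul_rpow (show 0 < ε / 3 by positivity)
  have hCτ0 : 0 ≤ Cτ := zero_le_one.trans hCτ1
  refine ⟨62 * (2 * (Cτ * (3 : ℝ) ^ ε) + 4), by positivity, ?_⟩
  intro q _ V A B S hV hVA hBV hS
  classical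
  have hq : 0 < q := Nat.pos_of_ne_zero (NeZero.ne q)
  have hqR : (0 : ℝ) < q := by exact_mod_cast hq
  have hq1 : (1 : ℝ) ≤ q := by exact_mod_cast hq
  have hV0 : 0 < V := by linarith
  have hsq : 0 < Real.sqrt q := Real.sqrt_pos.mpr hqR
  -- notation and elementary sizes
  set a : ℝ := ((B - A : ℕ) : ℝ) with ha
  set J : ℝ := ((B - A : ℕ) : ℝ) + 1 with hJ
  have ha0 : 0 ≤ a := Nat.cast_nonneg _
  have hJ1 : 1 ≤ J := by rw [hJ]; linarith
  have haJ : a ≤ J := by rw [hJ, ha]; linarith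
  have hJV : J ≤ 2 * V := by
    rcases le_or_gt A B with hAB | hAB
    · have hA1 : (1 : ℝ) ≤ A := hV.trans hVA
      have : ((B - A : ℕ) : ℝ) = (B : ℝ) - A := Nat.cast_sub hAB
      rw [hJ, this]; linarith
    · have : ((B - A : ℕ) : ℝ) = 0 := by rw [Nat.sub_eq_zero_of_le hAB.le, Nat.cast_zero]
      rw [hJ, this]; linarith
  set P : ℝ := 1 + V ^ 2 / q + V * Real.sqrt V / Real.sqrt q with hP
  have hnn1 : 0 ≤ V ^ 2 / q := by positivity
  have hnn2 : 0 ≤ V * Real.sqrt V / Real.sqrt q := by positivity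
  have hP1 : 1 ≤ P := by rw [hP]; linarith
  have hP0 : 0 ≤ P := by linarith
  have hPq : V ^ 2 / q ≤ P := by rw [hP]; linarith
  have hcS : (S.card : ℝ) ≤ a := by
    have := Finset.card_le_card hS
    rw [Nat.card_Ioc] at this
    rw [ha]; exact_mod_cast this
  have hcS0 : (0 : ℝ) ≤ S.card := Nat.cast_nonneg _
  have hdiv1 : (1 : ℝ) ≤ (Nat.divisors q).card := by
    have : 0 < (Nat.divisors q).card := Finset.card_pos.mpr ⟨1, Nat.one_mem_divisors.mpr hq.ne'⟩
    exact_mod_cast this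
  -- the divisor bound `M`
  set M : ℝ := Cτ * ((3 : ℝ) * q * V) ^ ε with hM
  have hM0 : 0 ≤ M := by positivity
  have hMbound : ∀ n : ℕ, n ≠ 0 → (n : ℝ) ≤ 9 * (q : ℝ) ^ 3 * V ^ 2 → (n.divisors.card : ℝ) ≤ M := by
    intro n hn hnle
    have h1 := hCτ n hn
    have h3 : (n : ℝ) ≤ ((3 : ℝ) * q * V) ^ (3 : ℕ) := by
      refine hnle.trans ?_
      have hq3 : 0 ≤ (q : ℝ) ^ 3 := by positivity
      have hV23 : V ^ 2 ≤ V ^ 3 := pow_le_pow_right₀ hV (by norm_num)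
      calc 9 * (q : ℝ) ^ 3 * V ^ 2 ≤ 27 * (q : ℝ) ^ 3 * V ^ 3 := by nlinarith
        _ = ((3 : ℝ) * q * V) ^ (3 : ℕ) := by ring
    have h2 : (n : ℝ) ^ (ε / 3) ≤ ((3 : ℝ) * q * V) ^ ε := by
      calc (n : ℝ) ^ (ε / 3) ≤ (((3 : ℝ) * q * V) ^ (3 : ℕ)) ^ (ε / 3) :=
            Real.rpow_le_rpow (Nat.cast_nonneg _) h3 (by positivity)
        _ = ((3 : ℝ) * q * V) ^ ε := by
            rw [← Real.rpow_natCast, ← Real.rpow_mul (by positivity)]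
            congr 1; push_cast; ring
    calc (n.divisors.card : ℝ) ≤ Cτ * (n : ℝ) ^ (ε / 3) := h1
      _ ≤ Cτ * ((3 : ℝ) * q * V) ^ ε := by gcongr
  -- `2M + 4 ≤ (2Cτ3^ε + 4)(qV)^ε`
  have hqV1 : (1 : ℝ) ≤ (q : ℝ) * V := one_le_mul_of_one_le_of_one_le hq1 hV
  have hpow1 : (1 : ℝ) ≤ ((q : ℝ) * V) ^ ε := Real.one_le_rpow hqV1 hε.le
  have hM2 : 2 * M + 4 ≤ (2 * (Cτ * (3 : ℝ) ^ ε) + 4) * ((q : ℝ) * V) ^ ε := by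
    have e : M = Cτ * (3 : ℝ) ^ ε * ((q : ℝ) * V) ^ ε := by
      rw [hM, show (3 : ℝ) * q * V = 3 * ((q : ℝ) * V) by ring,
        Real.mul_rpow (by norm_num) (by positivity)]
      ring
    rw [e]
    calc 2 * (Cτ * (3 : ℝ) ^ ε * ((q : ℝ) * V) ^ ε) + 4
        ≤ 2 * (Cτ * (3 : ℝ) ^ ε * ((q : ℝ) * V) ^ ε) + 4 * ((q : ℝ) * V) ^ ε := by linarith
      _ = (2 * (Cτ * (3 : ℝ) ^ ε) + 4) * ((q : ℝ) * V) ^ ε := by ring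
  have hK : (Nat.divisors q).card * (62 * (2 * M + 4) * J ^ 2 * P) ≤
      62 * (2 * (Cτ * (3 : ℝ) ^ ε) + 4) * ((q : ℝ) * V) ^ ε * (Nat.divisors q).card * (J ^ 2 * P) := by
    have : 62 * (2 * M + 4) * J ^ 2 * P ≤ 62 * ((2 * (Cτ * (3 : ℝ) ^ ε) + 4) * ((q : ℝ) * V) ^ ε) * J ^ 2 * P := by
      gcongr
    calc (Nat.divisors q).card * (62 * (2 * M + 4) * J ^ 2 * P)
        ≤ (Nat.divisors q).card * (62 * ((2 * (Cτ * (3 : ℝ) ^ ε) + 4) * ((q : ℝ) * V) ^ ε) * J ^ 2 * P) := by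
          gcongr
      _ = 62 * (2 * (Cτ * (3 : ℝ) ^ ε) + 4) * ((q : ℝ) * V) ^ ε * (Nat.divisors q).card * (J ^ 2 * P) := by
          ring
  -- `H` as a real sum, and `∑_s m(s)`
  have hH : ((invEnergy q S : ℕ) : ℝ) = ∑ s : ZMod q, ((invPairCount q S s : ℕ) : ℝ) ^ 2 := by
    unfold invEnergy; push_cast; rfl
  have hsum : ∑ s : ZMod q, ((invPairCount q S s : ℕ) : ℝ) ≤ J ^ 2 := by
    have e : ∑ s : ZMod q, ((invPairCount q S s : ℕ) : ℝ) = ((unitsIn q S).card : ℝ) ^ 2 := by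
      exact_mod_cast sum_invPairCount q S
    rw [e]
    have : ((unitsIn q S).card : ℝ) ≤ J := (Nat.cast_le.mpr (card_unitsIn_le S)).trans (hcS.trans haJ)
    gcongr
  have hmax : ∀ s, ((invPairCount q S s : ℕ) : ℝ) ≤ (S.card : ℝ) * (a / q + 1) := fun s =>
    invPairCount_le hq hS s
  rw [hH]
  refine le_trans ?_ hK
  rcases lt_or_ge (q : ℝ) J with hJq | hJq
  · -- the trivial bound (6.8): `J > q`
    have h1 : ∑ s : ZMod q, ((invPairCount q S s : ℕ) : ℝ) ^ 2 ≤
        (S.card : ℝ) * (a / q + 1) * J ^ 2 := by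
      calc ∑ s : ZMod q, ((invPairCount q S s : ℕ) : ℝ) ^ 2
          ≤ ∑ s : ZMod q, (S.card : ℝ) * (a / q + 1) * ((invPairCount q S s : ℕ) : ℝ) :=
            Finset.sum_le_sum fun s _ => by
              rw [sq]; exact mul_le_mul_of_nonneg_right (hmax s) (Nat.cast_nonneg _)
        _ = (S.card : ℝ) * (a / q + 1) * ∑ s : ZMod q, ((invPairCount q S s : ℕ) : ℝ) := by
            rw [Finset.mul_sum]
        _ ≤ (S.card : ℝ) * (a / q + 1) * J ^ 2 := by gcongr
    have h2 : (S.card : ℝ) * (a / q + 1) ≤ J * (2 * J / q) := by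
      have : a / q + 1 ≤ 2 * J / q := by
        rw [div_add_one hqR.ne', div_le_div_iff_of_pos_right hqR]; linarith
      exact mul_le_mul (hcS.trans haJ) this (by positivity) (by positivity)
    have h3 : J * (2 * J / q) * J ^ 2 ≤ 8 * (J ^ 2 * (V ^ 2 / q)) := by
      have hJ2 : J ^ 2 ≤ 4 * V ^ 2 := by
        calc J ^ 2 ≤ (2 * V) ^ 2 := by gcongr
          _ = 4 * V ^ 2 := by ring
      calc J * (2 * J / q) * J ^ 2 = 2 * J ^ 2 * (J ^ 2 / q) := by ring
        _ ≤ 2 * J ^ 2 * (4 * V ^ 2 / q) := by gcongr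
        _ = 8 * (J ^ 2 * (V ^ 2 / q)) := by ring
    calc ∑ s : ZMod q, ((invPairCount q S s : ℕ) : ℝ) ^ 2 ≤ (S.card : ℝ) * (a / q + 1) * J ^ 2 := h1
      _ ≤ J * (2 * J / q) * J ^ 2 := by gcongr
      _ ≤ 8 * (J ^ 2 * (V ^ 2 / q)) := h3
      _ ≤ 8 * (J ^ 2 * P) := by gcongr
      _ = 1 * (8 * 1 * J ^ 2 * P) := by ring
      _ ≤ (Nat.divisors q).card * (62 * (2 * M + 4) * J ^ 2 * P) := by
          gcongr
          · norm_num
          · linarith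
  · -- the main case `J ≤ q`
    have haq : a / q + 1 ≤ 2 := by
      have : a / q ≤ 1 := by rw [div_le_one hqR]; linarith
      linarith
    set D₀ : ℕ := 1 + ⌊Real.sqrt q * J / V⌋₊ with hD₀
    have hD₀lt : Real.sqrt q * J / V < D₀ := by
      rw [hD₀]; push_cast
      have := Nat.lt_floor_add_one (Real.sqrt q * J / V)
      linarith
    have hD₀le : (D₀ : ℝ) ≤ 1 + Real.sqrt q * J / V := by
      rw [hD₀]; push_cast
      have := Nat.floor_le (show 0 ≤ Real.sqrt q * J / V by positivity)
      linarith
    -- the pointwise bound according to `d = (s, q)`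
    set Bnd : ℕ → ℝ := fun d => if (2 * d ≤ q ∧ d ≤ D₀) then
        (8 * V ^ 2 * d / q + 16 * V * Real.sqrt V / Real.sqrt q + 3) * (2 * M + 2 * (a / q + 1))
      else (S.card : ℝ) * (a / q + 1) with hBnd
    have hBnd0 : ∀ d, 0 ≤ Bnd d := by
      intro d; simp only [hBnd]; split_ifs <;> positivity
    have hpt : ∀ s : ZMod q, ((invPairCount q S s : ℕ) : ℝ) ≤ Bnd (Nat.gcd s.val q) := by
      intro s
      simp only [hBnd]
      split_ifs with h
      · exact invPairCount_le_of_gcd hS hV hBV s h.1 hMbound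
      · exact hmax s
    set g : ZMod q → ℕ := fun s => Nat.gcd s.val q with hg
    have hgmem : ∀ s ∈ (Finset.univ : Finset (ZMod q)), g s ∈ Nat.divisors q := fun s _ =>
      Nat.mem_divisors.mpr ⟨Nat.gcd_dvd_right _ _, hq.ne'⟩
    -- Step 2: `∑ m² ≤ ∑ Bnd(g s) m(s)`
    have step2 : ∑ s : ZMod q, ((invPairCount q S s : ℕ) : ℝ) ^ 2 ≤
        ∑ s : ZMod q, Bnd (g s) * ((invPairCount q S s : ℕ) : ℝ) :=
      Finset.sum_le_sum fun s _ => by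
        rw [sq]; exact mul_le_mul_of_nonneg_right (hpt s) (Nat.cast_nonneg _)
    -- Step 3: collect according to `d`
    have step3 : ∑ s : ZMod q, Bnd (g s) * ((invPairCount q S s : ℕ) : ℝ) =
        ∑ d ∈ Nat.divisors q, Bnd d *
          ∑ s ∈ (Finset.univ : Finset (ZMod q)).filter (fun s => g s = d), ((invPairCount q S s : ℕ) : ℝ) := by
      rw [← Finset.sum_fiberwise_of_maps_to hgmem]
      refine Finset.sum_congr rfl fun d _ => ?_
      rw [Finset.mul_sum]
      refine Finset.sum_congr rfl fun s hs => ?_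
      rw [(Finset.mem_filter.mp hs).2]
    -- Step 4: each fibre by (6.9)
    have step4 : ∀ d ∈ Nat.divisors q,
        ∑ s ∈ (Finset.univ : Finset (ZMod q)).filter (fun s => g s = d), ((invPairCount q S s : ℕ) : ℝ) ≤
          (S.card : ℝ) * (a / d + 1) := by
      intro d hd
      obtain ⟨hdq, -⟩ := Nat.mem_divisors.mp hd
      have hd0 : 0 < d := Nat.pos_of_dvd_of_pos hdq hq
      haveI : NeZero d := ⟨hd0.ne'⟩
      have hsub : (Finset.univ : Finset (ZMod q)).filter (fun s => g s = d) ⊆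
          (Finset.univ : Finset (ZMod q)).filter (fun s => (ZMod.castHom hdq (ZMod d) s) = 0) := by
        intro s hs
        rw [Finset.mem_filter] at hs ⊢
        refine ⟨hs.1, ?_⟩
        rw [ZMod.castHom_apply, ZMod.cast_eq_val, ZMod.natCast_eq_zero_iff]
        rw [← hs.2]
        exact Nat.gcd_dvd_left _ _
      calc ∑ s ∈ (Finset.univ : Finset (ZMod q)).filter (fun s => g s = d), ((invPairCount q S s : ℕ) : ℝ)
          ≤ ∑ s ∈ (Finset.univ : Finset (ZMod q)).filter (fun s => (ZMod.castHom hdq (ZMod d) s) = 0),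
              ((invPairCount q S s : ℕ) : ℝ) :=
            Finset.sum_le_sum_of_subset_of_nonneg hsub fun s _ _ => Nat.cast_nonneg _
        _ ≤ (S.card : ℝ) * (a / d + 1) := by
            have := sum_invPairCount_cast_eq_zero_le hd0 hdq hS (q := q)
            push_cast at this
            exact this
    -- Step 5: the per-divisor bounds
    have step5 : ∀ d ∈ Nat.divisors q, Bnd d * ((S.card : ℝ) * (a / d + 1)) ≤
        62 * (2 * M + 4) * J ^ 2 * P := by
      intro d hd
      obtain ⟨hdq, -⟩ := Nat.mem_divisors.mp hd
      have hd0 : 0 < d := Nat.pos_of_dvd_of_pos hdq hq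
      have hd1 : (1 : ℝ) ≤ d := by exact_mod_cast hd0
      simp only [hBnd]
      split_ifs with h
      · have hdD : (d : ℝ) ≤ 1 + Real.sqrt q * J / V := le_trans (by exact_mod_cast h.2) hD₀le
        exact perDivisor_le_of_small hV hqR hJ1 hM0 ha0 haJ haq hcS0 (hcS.trans haJ) hd1 hdD
      · have hcase : (D₀ : ℝ) < d ∨ (q : ℝ) < 2 * d := by
          rcases not_and_or.mp h with h' | h'
          · right; exact_mod_cast (not_le.mp h')
          · left; exact_mod_cast (not_le.mp h')
        exact perDivisor_le_of_large hV hqR hJ1 hJq hM0 ha0 haJ haq hcS0 (hcS.trans haJ) (by linarith)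
          hD₀lt hcase
    -- assemble
    calc ∑ s : ZMod q, ((invPairCount q S s : ℕ) : ℝ) ^ 2
        ≤ ∑ s : ZMod q, Bnd (g s) * ((invPairCount q S s : ℕ) : ℝ) := step2
      _ = ∑ d ∈ Nat.divisors q, Bnd d *
          ∑ s ∈ (Finset.univ : Finset (ZMod q)).filter (fun s => g s = d), ((invPairCount q S s : ℕ) : ℝ) :=
          step3
      _ ≤ ∑ d ∈ Nat.divisors q, Bnd d * ((S.card : ℝ) * (a / d + 1)) :=
          Finset.sum_le_sum fun d hd => mul_le_mul_of_nonneg_left (step4 d hd) (hBnd0 d)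
      _ ≤ ∑ _d ∈ Nat.divisors q, (62 * (2 * M + 4) * J ^ 2 * P) := Finset.sum_le_sum step5
      _ = (Nat.divisors q).card * (62 * (2 * M + 4) * J ^ 2 * P) := by rw [Finset.sum_const, nsmul_eq_mul]

end HeathBrown1986

end Literature.NumberTheory.Sieve

end
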